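import Summits.CriticalPhenomena.PercolationContinuityZ3.Theorems.PercNearOneGluingNoHeavyQuantGluedWindowFarTop
import HarnessLib

/-!
# QUANT lane R8, T-DEC: LEMMA W's pair condition — the FAR-FIT cell of the two-row regime (h a mid, `h` unreachable for the bottom copy of `l`: `l + h ≤ T`,
# the top copy reachable: `T < 2l+r+k`, and the middle copy FITS into the top copy) PROVED WITHOUT THE CONJECTURE by hand — case (i) of `…FarH` needs only
# `N ≥ d`, so it also serves `h − l ≤ T − 2l < h − l + r` (arm-1 gen 61, architect)

builds on p205010 (kernel theorem, internal audit signed; external expert review pending)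

Support file (`--supports stmt-CriticalPhenomena-4575`), QUANT lane seat prim-quant-arm-1 (gen 61, architect); memo
`run/shared/lean/prim/quant/prim-quant-arm-1-g61/ARCH-G61.md` §7.  Theorems only; standard axioms, no sorries, no definitions.

THE CELL.  As `…FarH` (`gluedPullback_windowPair_twoRow_farH`, p632451) but with the weaker reach hypothesis `l + h ≤ T` (the bottom copy cannot use `h`; the
middle copy may reach `h` and `h+r` — the certificate does not use them) and, in exchange, the FIT hypothesis of `…NearH`: the middle copy is light for the top
copy, or `q(1−g)(T−2l−2r) ≤ qg(2l+2r+k−T)` (`t₁ ≤ t₂ϖ_B`).  Certificate: row `l+r` ↦ share `θ = t₁/(t₂ϖ_B)` of `A`; row `l` ↦ the rest of `A` and the pool.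
The inequality `(1−γ)(t₀ − (1−θ)t₂ϖ_A) ≤ γt₂(1−y)/y` is `Y·ν ≤ ρ₀` (`farTop_ratio_heavy/_light`, `α ≤ t₁ε + t₂κ`), `ν = (T−2l)/(h−l) ≥ 1`, and `farTop_core`.
**`gluedPullback_windowPair_twoRow_farFit`**.  Together with `…NearH` (`y(h−l) ≤ T−2l < h−l`) every heavy-bottom configuration whose middle copy fits into
the top copy is kernel; what remains of the top-reachable heavy-bottom family is the non-fitting heavy middle copy with `T − 2l < h − l + r` (memo §7).

HONEST STATUS.  `GluedLemmaW` (flow form), `GluedDominatedMass`, the band, `SiblingStep`, `FarTreeRow` OPEN; RATE class (log\*) / honest sentence of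
`run/shared/lean/prim/quant/README.md` unchanged.  [this work].  Nothing here is cited as a published result.  The gluing rows served
[cite: KozmaNitzan2024, Conjecture 3 (p. 15)]; product measure [cite: Grimmett1999, §1.3 p. 10].
-/

set_option maxHeartbeats 4000000

noncomputable section

namespace Summit.CriticalPhenomena.PercolationContinuityZ3.Theorems
namespace Quant
namespace LawDec

/-- **THE FAR-FIT CELL OF THE TWO-ROW REGIME (h a mid)**: `l + h ≤ T` (the bottom copy of `l` cannot use `h`), `T < 2l + r + k` (it can use the top
copy), and the middle copy fits into the top copy (light for it, or `q(1−g)(T−2l−2r) ≤ qg(2l+2r+k−T)`) ⟹ `(1−γ)Ψ(l) + γΨ(h) ≤ 0` for every price system and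
every cheap `c ≥ h` — no `GluedLemmaW`. [this work] -/
theorem gluedPullback_windowPair_twoRow_farFit (x a q g S : ℝ) (B r k j l h c ls : ℕ) (α p : ℕ → ℝ)
    (hx0 : 0 < x) (hx1 : x < 1) (ha0 : 0 < a) (ha1 : a ≤ 1) (hq0 : 0 < q) (hq1 : q < 1) (hg0 : 0 ≤ g) (hg1 : g ≤ 1) (hr : 1 ≤ r) (hk : 1 ≤ k)
    (hxqg : x ≤ q * g)
    (hlh : l < h) (hhB : h ≤ B) (hwin : j < h + r + k) (hlow : 2 * (l : ℝ) < a * S) (hcomp : a * S < (l : ℝ) + h)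
    (hlight : pairGate (a * x) (a * S) l h < a * x)
    (hL2j : l + r + k ≤ j) (hL2mid : a * (S + q * ((r : ℝ) + k * g)) ≤ 2 * ((l : ℝ) + r + k))
    (hL1low : 2 * ((l : ℝ) + r) < a * (S + q * ((r : ℝ) + k * g))) (hhmid : a * (S + q * ((r : ℝ) + k * g)) ≤ 2 * (h : ℝ))
    (hAcomp : a * (S + q * ((r : ℝ) + k * g)) < 2 * (l : ℝ) + r + k)
    (hfar : (l : ℝ) + h ≤ a * (S + q * ((r : ℝ) + k * g)))
    (hcase : a * (S + q * ((r : ℝ) + k * g)) - 2 * ((l : ℝ) + r) ≤ (a * x) * (k : ℝ) ∨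
      q * (1 - g) * (a * (S + q * ((r : ℝ) + k * g)) - 2 * ((l : ℝ) + r)) ≤ q * g * (2 * ((l : ℝ) + r) + k - a * (S + q * ((r : ℝ) + k * g))))
    (hhc : h ≤ c) (hcB : c ≤ B) (hcj : c ≤ j)
    (hp : ∀ h, 0 ≤ p h)
    (hαp : ∀ l' h', l' ≤ j → 2 * (l' : ℝ) < a * (S + q * ((r : ℝ) + k * g)) → h' ≤ B + (r + k) →
      (j + 1 ≤ h' ∨ a * (S + q * ((r : ℝ) + k * g)) < (l' : ℝ) + h') →
      α l' ≤ usage (a * x) (a * (S + q * ((r : ℝ) + k * g))) j l' h' * p h')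
    (hcheap : -(gluedPullback (a * (S + q * ((r : ℝ) + k * g))) q g j r k α p c) * (a * x)
      < (1 - a * x) * gluedPullback (a * (S + q * ((r : ℝ) + k * g))) q g j r k α p ls) :
    (1 - pairGate (a * x) (a * S) l h) * gluedPullback (a * (S + q * ((r : ℝ) + k * g))) q g j r k α p l
      + pairGate (a * x) (a * S) l h * gluedPullback (a * (S + q * ((r : ℝ) + k * g))) q g j r k α p h ≤ 0 := by
  -- names (no `set`: the reduction theorem is applied to the original expressions at the end)
  obtain ⟨y, hy⟩ : ∃ y : ℝ, y = a * x := ⟨_, rfl⟩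
  obtain ⟨T, hT⟩ : ∃ T : ℝ, T = a * (S + q * ((r : ℝ) + k * g)) := ⟨_, rfl⟩
  obtain ⟨T₀, hT₀⟩ : ∃ T₀ : ℝ, T₀ = a * S := ⟨_, rfl⟩
  have hy0 : 0 < y := by rw [hy]; exact mul_pos ha0 hx0
  have hyx : y ≤ x := by rw [hy]; nlinarith
  have hy1 : y < 1 := by linarith
  have h1y : 0 < 1 - y := by linarith
  obtain ⟨t1, ht1⟩ : ∃ t1 : ℝ, t1 = q * (1 - g) := ⟨_, rfl⟩
  obtain ⟨t2, ht2⟩ : ∃ t2 : ℝ, t2 = q * g := ⟨_, rfl⟩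
  have ht1p : 0 ≤ t1 := by rw [ht1]; exact mul_nonneg hq0.le (by linarith)
  have ht2p : 0 ≤ t2 := by rw [ht2]; exact mul_nonneg hq0.le hg0
  have ht0p : 0 ≤ 1 - t1 - t2 := by
    rw [ht1, ht2, show 1 - q * (1 - g) - q * g = 1 - q by ring]; linarith
  have hyt2 : y ≤ t2 := by rw [ht2]; linarith
  have hr1 : (1:ℝ) ≤ r := by exact_mod_cast hr
  have hk0 : (0:ℝ) ≤ k := Nat.cast_nonneg k
  have hr0 : (0:ℝ) ≤ r := by linarith
  have hlh' : (l : ℝ) < h := by exact_mod_cast hlh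
  -- geometry: d = h − l, N = T − 2l, A = T − T₀ ≤ m = t1 r + t2 (r+k)
  obtain ⟨d, hd⟩ : ∃ d : ℝ, d = (h : ℝ) - l := ⟨_, rfl⟩
  have hd0 : 0 < d := by rw [hd]; linarith
  obtain ⟨N, hN⟩ : ∃ N : ℝ, N = T - 2 * (l : ℝ) := ⟨_, rfl⟩
  have hA : T - T₀ = a * (q * ((r : ℝ) + k * g)) := by rw [hT, hT₀]; ring
  have em : q * (1 - g) * (r : ℝ) + q * g * ((r : ℝ) + k) = q * ((r : ℝ) + k * g) := by ring
  have hAm : T - T₀ ≤ t1 * r + t2 * ((r : ℝ) + k) := by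
    rw [hA, ht1, ht2]
    have h1 : a * (q * ((r : ℝ) + k * g)) ≤ 1 * (q * ((r : ℝ) + k * g)) :=
      mul_le_mul_of_nonneg_right ha1 (by positivity)
    linarith [h1, em]
  have hA0 : 0 ≤ T - T₀ := by rw [hA]; positivity
  have hN0 : 0 < N := by rw [hN, hT]; linarith
  have hNK : N < (r : ℝ) + k := by rw [hN, hT]; linarith              -- row l compatible with A
  have hNfar : d ≤ N := by rw [hN, hd, hT]; linarith      -- h unreachable for the bottom row
  have hN2d : N ≤ 2 * d := by rw [hN, hd, hT]; linarith
  have h2rN : 2 * (r : ℝ) < N := by rw [hN, hT]; linarith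
  -- y (r+k) ≤ a m ≤ N: the bottom copy is HEAVY for the top copy (automatic in the band)
  have hxq : x ≤ q := le_trans hxqg (by nlinarith)
  have hxK : x * ((r : ℝ) + k) ≤ q * ((r : ℝ) + k * g) := by
    have e1 : x * (r : ℝ) ≤ q * r := mul_le_mul_of_nonneg_right hxq hr0
    have e2 : x * (k : ℝ) ≤ q * g * k := mul_le_mul_of_nonneg_right hxqg hk0
    linarith [e1, e2]
  have hyK : y * ((r : ℝ) + k) ≤ N := by
    have e1 : y * ((r : ℝ) + k) ≤ T - T₀ := by
      rw [hy, hA, mul_assoc]; exact mul_le_mul_of_nonneg_left hxK ha0.le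
    rw [hN]; rw [hT₀] at e1; linarith
  -- the light gate of the first factor
  obtain ⟨ρ₀, hρ₀⟩ : ∃ ρ₀ : ℝ, ρ₀ = (T₀ - 2 * (l : ℝ)) / ((h : ℝ) - l) := ⟨_, rfl⟩
  have hρ₀y : ρ₀ < y := by
    have : (T₀ - 2 * (l : ℝ)) / ((h : ℝ) - l) ≤ pairGate y T₀ l h := le_max_left _ _
    rw [hρ₀]; rw [hy, hT₀] at this ⊢; linarith
  obtain ⟨γ, hγ⟩ : ∃ γ : ℝ, γ = y ^ 2 + (1 - y) * ρ₀ := ⟨_, rfl⟩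
  have hγ' : pairGate (a * x) (a * S) l h = γ := by
    rw [hγ, hρ₀, hT₀, hy]; exact pairGate_eq_light (a * x) (a * S) l h (mul_pos ha0 hx0).le (by rw [← hy, ← hT₀, ← hρ₀]; exact hρ₀y.le)
  have eρ₀ : ρ₀ = (N - (T - T₀)) / d := by rw [hρ₀, hN, hd]; congr 1; ring
  have hρ₀0 : 0 < ρ₀ := by rw [hρ₀]; exact div_pos (by rw [hT₀]; linarith) (by linarith)
  have hγ0 : 0 < γ := by rw [hγ]; exact add_pos_of_pos_of_nonneg (pow_pos hy0 2) (mul_pos h1y hρ₀0).le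
  have h1γ : 0 < 1 - γ := by
    rw [hγ, show 1 - (y ^ 2 + (1 - y) * ρ₀) = (1 - y) * (1 + y - ρ₀) by ring]; exact mul_pos h1y (by linarith)
  have hlowl : 2 * (l : ℝ) < T := by linarith
  have eLr : ((l + r : ℕ) : ℝ) = (l : ℝ) + r := by push_cast; ring
  have eL2 : ((l + r + k : ℕ) : ℝ) = (l : ℝ) + r + k := by push_cast; ring
  have hlowlr : 2 * ((l + r : ℕ) : ℝ) < T := by rw [eLr]; linarith
  -- the top copy A = l + r + k: exact heavy power for row l
  obtain ⟨ϖA, hϖA⟩ : ∃ ϖA : ℝ, ϖA = ((l : ℝ) + ((l + r + k : ℕ) : ℝ) - T) / (T - 2 * (l : ℝ)) := ⟨_, rfl⟩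
  have hAcomp' : T < (l : ℝ) + ((l + r + k : ℕ) : ℝ) := by rw [eL2]; rw [hN] at hNK; linarith
  have hAheavy : y * ((((l + r + k : ℕ) : ℝ)) - l) ≤ T - 2 * (l : ℝ) := by rw [eL2, ← hN]; linarith [hyK]
  have vA : ϖA * usage y T j l (l + r + k) ≤ 1 := by
    have e := GluedWindow.apow_heavy_valid y T 1 j l (l + r + k) hy0 hy1 hL2j hlowl hAcomp' hAheavy
    rw [← hϖA, one_mul] at e
    exact e.le
  have eϖA : ϖA = ((r : ℝ) + k - N) / N := by rw [hϖA, eL2, hN]; congr 1; ring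
  have hϖA0 : 0 ≤ ϖA := by rw [eϖA]; exact div_nonneg (by linarith) hN0.le
  -- box coordinates
  obtain ⟨nu, hnu⟩ : ∃ nu : ℝ, nu = N / d := ⟨_, rfl⟩
  obtain ⟨ee, hee⟩ : ∃ ee : ℝ, ee = (r : ℝ) / d := ⟨_, rfl⟩
  obtain ⟨kk, hkk⟩ : ∃ kk : ℝ, kk = ((r : ℝ) + k) / d := ⟨_, rfl⟩
  obtain ⟨aa, haa⟩ : ∃ aa : ℝ, aa = (T - T₀) / d := ⟨_, rfl⟩
  have hnu1 : 1 ≤ nu := by rw [hnu, le_div_iff₀ hd0]; linarith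
  have hee0 : 0 ≤ ee := by rw [hee]; positivity
  have hn0 : 0 < nu := by linarith
  have hn2 : 2 * ee < nu := by
    rw [hee, hnu, show 2 * ((r : ℝ) / d) = (2 * r) / d by ring]; exact div_lt_div_of_pos_right h2rN hd0
  have hkkn : nu < kk := by rw [hkk, hnu]; exact div_lt_div_of_pos_right hNK hd0
  have hkky : y * kk ≤ nu := by rw [hkk, hnu, ← mul_div_assoc]; exact div_le_div_of_nonneg_right hyK hd0.le
  have eϖA' : ϖA = (kk - nu) / nu := by rw [eϖA, hnu, hkk, ← sub_div, div_div_div_cancel_right₀ hd0.ne']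
  have eρ₀' : ρ₀ = nu - aa := by rw [eρ₀, hnu, haa, sub_div]
  have haamax : aa ≤ t1 * ee + t2 * kk := by
    rw [haa, hee, hkk, show t1 * ((r : ℝ) / d) + t2 * (((r : ℝ) + k) / d) = (t1 * r + t2 * ((r : ℝ) + k)) / d by ring]
    exact div_le_div_of_nonneg_right hAm hd0.le
  -- the pool power (plain giant rate) and the core inequality
  obtain ⟨pu, hpu⟩ : ∃ pu : ℝ, pu = (1 - y) / y := ⟨_, rfl⟩
  have hpu0 : 0 ≤ pu := by rw [hpu]; exact div_nonneg h1y.le hy0.le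
  have vP : pu * (y / (1 - y)) ≤ 1 := by rw [hpu, div_mul_div_comm, mul_comm (1 - y) y, div_self (mul_ne_zero hy0.ne' h1y.ne')]
  have core : (1 - γ) * ρ₀ ≤ γ * t2 * pu := by rw [hγ, hpu]; exact farTop_core y t2 ρ₀ hy0 hy1 hyt2 hρ₀0.le
  have et0 : 1 - t1 - t2 = 1 - q := by rw [ht1, ht2]; ring
  have hι01 : ∀ ι : ℝ, ((h + r ≤ j ∧ ι = 0) ∨ (j < h + r ∧ ι = 1)) → 0 ≤ ι := by
    rintro ι (⟨_, e⟩ | ⟨_, e⟩) <;> norm_num [e]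
  -- the middle copy into A, by status, and the certificate
  obtain ⟨ι, hι⟩ : ∃ ι : ℝ, (h + r ≤ j ∧ ι = 0) ∨ (j < h + r ∧ ι = 1) := by
    by_cases hjr : h + r ≤ j
    · exact ⟨0, Or.inl ⟨hjr, rfl⟩⟩
    · exact ⟨1, Or.inr ⟨by omega, rfl⟩⟩
  have hι0 := hι01 ι hι
  have hpool_extra : 0 ≤ γ * (ι * t1) * pu := mul_nonneg (mul_nonneg hγ0.le (mul_nonneg hι0 ht1p)) hpu0
  -- generic final step: given a valid power ϖB ≥ 0 for (l+r, A) with ν ϖA ≤ (ν − ee) ϖB and t1 ≤ t2 ϖB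
  have finish : ∀ ϖB : ℝ, 0 ≤ ϖB → ϖB * usage y T j (l + r) (l + r + k) ≤ 1 → nu * ϖA ≤ (nu - ee) * ϖB → t1 ≤ t2 * ϖB →
      (1 - pairGate (a * x) (a * S) l h) * gluedPullback (a * (S + q * ((r : ℝ) + k * g))) q g j r k α p l
        + pairGate (a * x) (a * S) l h * gluedPullback (a * (S + q * ((r : ℝ) + k * g))) q g j r k α p h ≤ 0 := by
    intro ϖB hϖB0 vB hratio hfit
    have hBcomp' : T < ((l + r : ℕ) : ℝ) + ((l + r + k : ℕ) : ℝ) := by rw [eLr, eL2]; rw [hN] at hNK; linarith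
    · -- row l+r ↦ θ of A; row l ↦ 1−θ of A and the whole pool
      have ht2pos : 0 < t2 := lt_of_lt_of_le hy0 hyt2
      obtain ⟨θ, hθ0, hθ1, hθc⟩ : ∃ θ : ℝ, 0 ≤ θ ∧ θ ≤ 1 ∧ θ * (t2 * ϖB) = t1 := by
        by_cases hB0 : t2 * ϖB = 0
        · refine ⟨0, le_rfl, zero_le_one, ?_⟩
          rw [hB0] at hfit; rw [zero_mul]; linarith
        · have hBpos : 0 < t2 * ϖB := lt_of_le_of_ne (mul_nonneg ht2p hϖB0) (Ne.symm hB0)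
          exact ⟨t1 / (t2 * ϖB), div_nonneg ht1p hBpos.le, (div_le_one hBpos).mpr hfit, div_mul_cancel₀ _ hBpos.ne'⟩
      -- main (i): (1−γ)(t0 − (1−θ) t2 ϖA) ≤ γ t2 pu
      have hYν : ((1 - t1 - t2) - (1 - θ) * t2 * ϖA) * nu ≤ ρ₀ := by
        have e1 : ((1 - t1 - t2) - (1 - θ) * t2 * ϖA) * nu = nu - t1 * nu - t2 * (nu + nu * ϖA) + θ * t2 * (nu * ϖA) := by ring
        have e2 : nu + nu * ϖA = kk := by rw [eϖA', mul_div_cancel₀ _ hn0.ne']; ring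
        have h3 : θ * t2 * (nu * ϖA) ≤ θ * t2 * ((nu - ee) * ϖB) := mul_le_mul_of_nonneg_left hratio (mul_nonneg hθ0 ht2p)
        have e4 : θ * t2 * ((nu - ee) * ϖB) = θ * (t2 * ϖB) * (nu - ee) := by ring
        rw [e4, hθc] at h3
        rw [e1, e2]
        linarith [h3, haamax, eρ₀']
      have main : (1 - γ) * ((1 - t1 - t2) - (1 - θ) * t2 * ϖA) ≤ γ * t2 * pu := by
        by_cases hYs : (1 - t1 - t2) - (1 - θ) * t2 * ϖA ≤ 0
        · exact le_trans (mul_nonpos_of_nonneg_of_nonpos h1γ.le hYs) (mul_nonneg (mul_nonneg hγ0.le ht2p) hpu0)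
        · have hYpos : 0 < (1 - t1 - t2) - (1 - θ) * t2 * ϖA := lt_of_not_ge hYs
          have hYle : (1 - t1 - t2) - (1 - θ) * t2 * ϖA ≤ ρ₀ := by
            have hp := mul_nonneg hYpos.le (show (0:ℝ) ≤ nu - 1 by linarith)
            linarith [hYν, hp]
          exact le_trans (mul_le_mul_of_nonneg_left hYle h1γ.le) core
      have h1θ : 0 ≤ 1 - θ := by linarith
      refine gluedPullback_windowPair_twoRow_mid_of_assign x a q g S B r k j l h c ls α p ι ϖA 0 0 pu ϖB 0 0 pu
        (1 - θ) 0 0 1 θ 0 0 0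
        hx0 hx1 ha0 ha1 hq0 hq1 hg0 hg1 hr hlh hhB hwin hlow hcomp hL2j hL2mid hL1low hhmid hι hhc hcB hcj hp hαp hcheap
        hϖA0 le_rfl le_rfl hpu0 hϖB0 le_rfl le_rfl hpu0 h1θ le_rfl le_rfl zero_le_one hθ0 le_rfl le_rfl le_rfl
        (by linarith) (by linarith) (by linarith) (by linarith)
        ?_ (Or.inr ?_) ?_ (Or.inl rfl) ?_ (Or.inl rfl) (Or.inl ?_) ?_ (Or.inr ?_) ?_ (Or.inl rfl) ?_ (Or.inl rfl) (Or.inl ?_) ?_ ?_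
      · rw [← hy, ← hT]; exact vA
      · rw [← hT, ← eL2]; exact hAcomp'
      · rw [zero_mul]; exact zero_le_one
      · rw [zero_mul]; exact zero_le_one
      · rw [← hy]; exact vP
      · rw [← hy, ← hT]; exact vB
      · rw [← hT, ← eL2, ← eLr]; exact hBcomp'
      · rw [zero_mul]; exact zero_le_one
      · rw [zero_mul]; exact zero_le_one
      · rw [← hy]; exact vP
      · rw [hγ', ← ht1, ← ht2, ← et0]
        have e : (1 - θ) * ((1 - γ) * t2 * ϖA) + 0 * (γ * (1 - t1 - t2) * 0) + 0 * (γ * t1 * (1 - ι) * 0) + 1 * (γ * (t2 + ι * t1) * pu)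
            = (1 - γ) * ((1 - θ) * t2 * ϖA) + γ * t2 * pu + γ * (ι * t1) * pu := by ring
        rw [e]; linarith [main, hpool_extra]
      · rw [hγ', ← ht1, ← ht2]
        have e : θ * ((1 - γ) * t2 * ϖB) + 0 * (γ * (1 - q) * 0) + 0 * (γ * t1 * (1 - ι) * 0) + 0 * (γ * (t2 + ι * t1) * pu)
            = θ * (t2 * ϖB) * (1 - γ) := by ring
        rw [e, hθc, mul_comm]
  -- instantiate by the status of the middle copy w.r.t. A
  by_cases hBst : y * (k : ℝ) < N - 2 * (r : ℝ)
  · -- heavy: exact heavy power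
    obtain ⟨ϖB, hϖB⟩ : ∃ ϖB : ℝ, ϖB = (((l + r : ℕ) : ℝ) + ((l + r + k : ℕ) : ℝ) - T) / (T - 2 * ((l + r : ℕ) : ℝ)) := ⟨_, rfl⟩
    have hBcomp' : T < ((l + r : ℕ) : ℝ) + ((l + r + k : ℕ) : ℝ) := by rw [eLr, eL2]; rw [hN] at hNK; linarith
    have hBheavy' : y * ((((l + r + k : ℕ) : ℝ)) - ((l + r : ℕ) : ℝ)) ≤ T - 2 * ((l + r : ℕ) : ℝ) := by
      rw [eL2, eLr, show (l : ℝ) + r + k - ((l : ℝ) + r) = k by ring]; rw [hN] at hBst; linarith [hBst]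
    have vB : ϖB * usage y T j (l + r) (l + r + k) ≤ 1 := by
      have e := GluedWindow.apow_heavy_valid y T 1 j (l + r) (l + r + k) hy0 hy1 hL2j hlowlr hBcomp' hBheavy'
      rw [← hϖB, one_mul] at e
      exact e.le
    have eϖB1 : ϖB = ((r : ℝ) + k + r - N) / (N - 2 * (r : ℝ)) := by rw [hϖB, eL2, eLr, hN]; congr 1 <;> ring
    have eϖB : ϖB = (kk + ee - nu) / (nu - 2 * ee) := by
      rw [eϖB1, hkk, hee, hnu, ← add_div, ← sub_div, show N / d - 2 * ((r : ℝ) / d) = (N - 2 * r) / d by ring,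
        div_div_div_cancel_right₀ hd0.ne']
    have hϖB0 : 0 ≤ ϖB := by rw [eϖB]; exact div_nonneg (by linarith) (by linarith)
    refine finish ϖB hϖB0 vB ?_ ?_
    · rw [eϖA', eϖB]; exact farTop_ratio_heavy nu ee kk hee0 hn2 hkkn.le
    · rcases hcase with h1 | h1
      · exfalso; rw [hy, hN, hT] at hBst; linarith
      · rw [eϖB1, ← mul_div_assoc, le_div_iff₀ (by linarith : (0:ℝ) < N - 2 * (r : ℝ)), ht1, ht2]
        rw [hN, hT]; linarith [h1]
  · -- light: exact light power
    have hBlight : N - 2 * (r : ℝ) ≤ y * (k : ℝ) := le_of_not_gt hBst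
    obtain ⟨ρB, hρB⟩ : ∃ ρB : ℝ, ρB = (T - 2 * ((l + r : ℕ) : ℝ)) / ((((l + r + k : ℕ) : ℝ)) - ((l + r : ℕ) : ℝ)) := ⟨_, rfl⟩
    have hk0' : (0:ℝ) < k := by linarith
    have eρB : ρB = (N - 2 * (r : ℝ)) / k := by rw [hρB, eL2, eLr, hN]; congr 1 <;> ring
    have hρBy : ρB ≤ y := by rw [eρB, div_le_iff₀ hk0']; linarith
    have hρB0 : 0 ≤ ρB := by rw [eρB]; exact div_nonneg (by linarith) hk0'.le
    obtain ⟨GB, hGB⟩ : ∃ GB : ℝ, GB = y ^ 2 + (1 - y) * ρB := ⟨_, rfl⟩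
    have hGBy : GB ≤ y := by rw [hGB]; nlinarith [mul_le_mul_of_nonneg_left hρBy h1y.le]
    have hGB0 : 0 < GB := by rw [hGB]; exact add_pos_of_pos_of_nonneg (pow_pos hy0 2) (mul_nonneg h1y.le hρB0)
    have hGB1 : 0 < 1 - GB := by linarith
    obtain ⟨ϖB, hϖB⟩ : ∃ ϖB : ℝ, ϖB = (1 - GB) / GB := ⟨_, rfl⟩
    have hϖB0 : 0 ≤ ϖB := by rw [hϖB]; exact div_nonneg hGB1.le hGB0.le
    have vB : ϖB * usage y T j (l + r) (l + r + k) ≤ 1 := by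
      rw [usage_light_eq y T j (l + r) (l + r + k) hy0.le hL2j (by rw [← hρB]; exact hρBy), ← hρB, ← hGB, hϖB, div_mul_div_comm,
        mul_comm (1 - GB) GB, div_self (mul_ne_zero hGB0.ne' hGB1.ne')]
    have eρB' : ρB = (nu - 2 * ee) / (kk - ee) := by
      rw [eρB, hnu, hee, hkk, ← sub_div, show N / d - 2 * ((r : ℝ) / d) = (N - 2 * r) / d by ring, show (r : ℝ) + k - r = k by ring,
        div_div_div_cancel_right₀ hd0.ne']
    have hBl : nu - 2 * ee ≤ y * (kk - ee) := by
      rw [hnu, hee, hkk, show N / d - 2 * ((r : ℝ) / d) = (N - 2 * r) / d by ring, show y * (((r : ℝ) + k) / d - (r : ℝ) / d) = (y * k) / d by ring]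
      exact div_le_div_of_nonneg_right hBlight hd0.le
    -- row l+r always fits: t1 ≤ 1 − y ≤ t2 ϖB
    have hfit : t1 ≤ t2 * ϖB := by
      have hϖBge : (1 - y) / y ≤ ϖB := by rw [hϖB, div_le_div_iff₀ hy0 hGB0]; nlinarith [hGBy]
      have h1 : 1 - y ≤ t2 * ϖB := by
        calc 1 - y = y * ((1 - y) / y) := by field_simp
          _ ≤ t2 * ϖB := mul_le_mul hyt2 hϖBge (div_nonneg h1y.le hy0.le) ht2p
      linarith
    refine finish ϖB hϖB0 vB ?_ hfit
    rw [eϖA', hϖB, hGB, eρB']; exact farTop_ratio_light y nu ee kk hy0 hy1 hee0 hn2 hkkn hkky hBl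

end LawDec
end Quant
end Summit.CriticalPhenomena.PercolationContinuityZ3.Theorems
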